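import Summits.BirchSwinnertonDyer.Rank1Residual.Additive.X3BranchResidualQuotSelmerFamilyLowerBound
import Summits.BirchSwinnertonDyer.Rank1Residual.Additive.X3BranchLayerKernelUnits
import Summits.BirchSwinnertonDyer.Rank1Residual.Additive.X3BranchKummerCubeAtThreeBasis
import Summits.BirchSwinnertonDyer.Rank1Residual.Additive.X3BranchLayerCyclotomicValuation
import HarnessLib

/-!
# X3 degenerate road, brick U5b: the CLASS-LEVEL U-side count `3^{#S − 1} ≤ #U(W[3]/Φ₀)` at layer `N`
# (cell `bsd-eis`, seat `bsd-eis-x3` gen 9; route K1 `AdditiveBranchIMC`, crux `GordTwoRankZeroOffCaseOne`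
# — supports only; THEOREMS ONLY)

HONEST FRAMING (`run/shared/lean/pub/bsd-eis/README.md` §4): the programme's target of record is the full
Birch–Swinnerton-Dyer formula for every `E/ℚ` of analytic rank `≤ 1`; this file assembles the U-side half
of the CLASS-LEVEL count of `x3-MEMO-11.md` §2 for the DEGENERATE X3♯(G-ord) rows at `p = 3`:
for a rational `3`-line `Φ₀` fixed pointwise, a cyclotomic `κ`, a set `S₀` of places away from `3` and
ANY layer `N`,
  `3^{#S − 1} ≤ #U(W[3]/Φ₀)`,  `S` = the primes of `ℚ_N` above `S₀`
(`X3Branch.pow_card_le_natCard_residualQuotSelmer_of_trivialLine_of_layer`).  No tables, no certificates: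
the `#S − 1` classes come from `S`-units of `ℚ_N` that are cubes modulo `9` (brick U5a
`KummerFamily.exists_kernel_sUnits`: Dirichlet's `S`-unit theorem, `rank 𝓞_{ℚ_N}^× = 3^N − 1`, the count of
local cubes via ODD ramification `e(w|3) = 3^N`), turned into Kummer classes of `U` by the abstract family
theorem H0 (`X3Branch.pow_card_le_natCard_residualQuotSelmer_of_trivialLine_of_family`) with
`G' = Gal(ℚ̄/ℚ_N)`: the cube roots of all conjugates are fixed by `D_{v₃} ∩ Gal(ℚ̄/ℚ_N)` by the `3`-adic
contraction on an integral basis (U2 `KummerLayerClasses.exists_goodRoot_of_congruence`), and independence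
modulo cubes in `ℚ_N^×` is independence modulo cubes of `S`-units.  Nothing is booked here.
References: [GreenbergVatsal2000] §2 pp. 26–30; [Washington1997] §13.1; [Omeara1963] §33F Thm. 33:10;
[SerreLocalFields1979] Ch. X §3.
-/

set_option autoImplicit false

noncomputable section

open scoped Classical AddSubgroup NumberField

namespace Summit.BirchSwinnertonDyer.Rank1Residual.Additive

open NumberField IsDedekindDomain Field WeierstrassCurve Finset WithZero
  Literature.NumberTheory.GaloisRepresentations
  Literature.NumberTheory.EllipticCurves
  Literature.NumberTheory.EllipticCurves.GreenbergSelmer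
  Literature.NumberTheory.EllipticCurves.GreenbergVatsal2000
  Literature.NumberTheory.EllipticCurves.Rank1Residual
  Literature.NumberTheory.NumberFields
  Summit.BirchSwinnertonDyer.Rank1Residual.X2.ResidualDevissageModules
  Summit.BirchSwinnertonDyer.Rank1Residual.X2.ResidualDevissageLine
  KummerLineClasses KummerLayerClasses

variable {W : WeierstrassCurve ℚ} [W.IsElliptic]

set_option maxHeartbeats 400000 in
/-- **The class-level U-side count at layer `N`: `3^{#S−1} ≤ #U(W[3]/Φ₀)`**, `S` the primes of the layer
`ℚ_N` of the cyclotomic `ℤ₃`-extension dividing `m₀ = ∏_{v ∈ S₀} ℓ_v` (`3 ∉ S₀`), for a rational `3`-line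
`Φ₀` fixed pointwise by `Γ_ℚ` (assuming `U` finite).  `S`-unit theorem for `ℚ_N` + cubes modulo `9`
(U5a) + good cube roots of conjugates (U2) + the abstract family theorem (H0) with `G' = Gal(ℚ̄/ℚ_N)`.
[cite: GreenbergVatsal2000, §2 pp. 26–30] [cite: Washington1997, §13.1]
[cite: Omeara1963, §33F Thm. 33:10] -/
theorem X3Branch.pow_card_le_natCard_residualQuotSelmer_of_trivialLine_of_layer
    [hp : Fact (Nat.Prime 3)] (κ : ZpExtension ℚ 3) (hκ : κ.IsCyclotomic)
    (S₀ : Finset (HeightOneSpectrum (𝓞 ℚ))) (hS₀ : ∀ v ∈ S₀, ((3 : ℕ) : 𝓞 ℚ) ∉ v.asIdeal)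
    {Φ₀ : AddSubgroup (W.geomTorsion ((3 : ℕ) : ℤ))} (hΦ : IsRationalLine W 3 Φ₀)
    (htriv : ∀ (σ : absoluteGaloisGroup ℚ) (Pt : geomTorsion W ((3 : ℕ) : ℤ)), Pt ∈ Φ₀ → σ • Pt = Pt)
    (N : ℕ) [Finite (residualQuotSelmer W 3 κ S₀ Φ₀ hΦ)] :
    haveI : FiniteDimensional ℚ (κ.layer N) := κ.finiteDimensional_layer_holds N
    haveI : NumberField (κ.layer N) := NumberField.of_module_finite ℚ (κ.layer N)
    3 ^ (Nat.card {w : HeightOneSpectrum (𝓞 (κ.layer N)) //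
        ((∏ v ∈ S₀, Rat.HeightOneSpectrum.natGenerator v : ℕ) : 𝓞 (κ.layer N)) ∈ w.asIdeal} - 1) ≤
      Nat.card (residualQuotSelmer W 3 κ S₀ Φ₀ hΦ) := by
  haveI : FiniteDimensional ℚ (κ.layer N) := κ.finiteDimensional_layer_holds N
  haveI : NumberField (κ.layer N) := NumberField.of_module_finite ℚ (κ.layer N)
  -- `m₀ = ∏ ℓ_v`, nonzero and prime to `3`
  have natCast_mem_iff : ∀ (v : HeightOneSpectrum (𝓞 ℚ)) (n : ℕ),
      (n : 𝓞 ℚ) ∈ v.asIdeal ↔ Rat.HeightOneSpectrum.natGenerator v ∣ n := fun v n => by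
    rw [Rat.HeightOneSpectrum.natGenerator_dvd_iff,
      ← map_natCast (Rat.IsIntegralClosure.intEquiv (𝓞 ℚ)) n, Ideal.apply_mem_of_equiv_iff]
  set m₀ : ℕ := ∏ v ∈ S₀, Rat.HeightOneSpectrum.natGenerator v with hm₀def
  have hm₀ : m₀ ≠ 0 := Finset.prod_ne_zero_iff.mpr
    fun v _ => (Rat.HeightOneSpectrum.prime_natGenerator v).ne_zero
  have h3 : ¬ 3 ∣ m₀ := by
    intro h
    obtain ⟨v, hv, hdvd⟩ := (Prime.dvd_finsetProd_iff Nat.prime_three.prime _).mp h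
    have h3v : Rat.HeightOneSpectrum.natGenerator v = 3 :=
      ((Nat.prime_dvd_prime_iff_eq Nat.prime_three (Rat.HeightOneSpectrum.prime_natGenerator v)).mp
        hdvd).symm
    exact hS₀ v hv ((natCast_mem_iff v 3).mpr (h3v ▸ dvd_rfl))
  -- odd ramification above `3` in `ℚ_N`
  have hodd : ∀ w : HeightOneSpectrum (𝓞 (κ.layer N)), (3 : 𝓞 (κ.layer N)) ∈ w.asIdeal →
      ∃ e : ℕ, Odd e ∧ w.valuation (κ.layer N) (3 : κ.layer N) = exp (-(e : ℤ)) := by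
    intro w hw
    have h := hκ.odd_ramification_layer (by decide) N w (by exact_mod_cast hw)
    simpa using h
  -- U5a: the kernel `S`-units
  obtain ⟨k, u, hk, hcong, hind⟩ := KummerFamily.exists_kernel_sUnits (K := κ.layer N) hm₀ h3 hodd
    {w | (m₀ : 𝓞 (κ.layer N)) ∈ w.asIdeal} rfl
  have hrank := ZpExtension.units_rank_layer_rat κ N
  have hfin := κ.finrank_layer_holds N
  have hkS : Nat.card ({w | (m₀ : 𝓞 (κ.layer N)) ∈ w.asIdeal} : Set (HeightOneSpectrum (𝓞 (κ.layer N)))) - 1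
      ≤ k := by
    rw [hrank, hfin] at hk
    have := Nat.one_le_pow N 3 (by norm_num)
    omega
  -- places of `ℚ` named by `m₀`
  have hnS₀ : ∀ (j : ℕ) (v : HeightOneSpectrum (𝓞 ℚ)), ((m₀ ^ j : ℕ) : 𝓞 ℚ) ∈ v.asIdeal → v ∈ S₀ := by
    intro j v hv
    rw [Nat.cast_pow] at hv
    have hv' := v.isPrime.mem_of_pow_mem _ hv
    rw [natCast_mem_iff, hm₀def, Prime.dvd_finsetProd_iff (Rat.HeightOneSpectrum.prime_natGenerator v).prime]
      at hv'
    obtain ⟨v', hv'S, hdvd⟩ := hv'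
    have heq : Rat.HeightOneSpectrum.natGenerator v = Rat.HeightOneSpectrum.natGenerator v' :=
      (Nat.prime_dvd_prime_iff_eq (Rat.HeightOneSpectrum.prime_natGenerator v)
        (Rat.HeightOneSpectrum.prime_natGenerator v')).mp hdvd
    have hvv' : v = v' := Rat.HeightOneSpectrum.primesEquiv.injective (Subtype.ext heq)
    rwa [hvv']
  -- integral models `A_j = m₀^{3e_j} u_j`, `B_j = m₀^{3e'_j} u_j⁻¹` of the units and their inverses
  have hU : ∀ j, ∃ (e : ℕ) (y : 𝓞 (κ.layer N)),
      algebraMap (𝓞 (κ.layer N)) (κ.layer N) y = (m₀ : κ.layer N) ^ e * ((u j : (κ.layer N)ˣ) : κ.layer N) := by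
    intro j
    obtain ⟨e, y, hy⟩ := KummerFamily.exists_pow_mul_mem_range (K := κ.layer N) hm₀
      ((Set.unitEquivUnitsInteger _ (κ.layer N) (u j) :
        (({w | (m₀ : 𝓞 (κ.layer N)) ∈ w.asIdeal} : Set _).integer (κ.layer N))ˣ) : _)
    exact ⟨e, y, by rw [hy, Set.val_unitEquivUnitsInteger_apply_coe]⟩
  have hU' : ∀ j, ∃ (e' : ℕ) (y' : 𝓞 (κ.layer N)),
      algebraMap (𝓞 (κ.layer N)) (κ.layer N) y' =
        (m₀ : κ.layer N) ^ e' * ((u j : (κ.layer N)ˣ)⁻¹ : (κ.layer N)ˣ) := by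
    intro j
    obtain ⟨e, y, hy⟩ := KummerFamily.exists_pow_mul_mem_range (K := κ.layer N) hm₀
      ((Set.unitEquivUnitsInteger _ (κ.layer N) (u j)⁻¹ :
        (({w | (m₀ : 𝓞 (κ.layer N)) ∈ w.asIdeal} : Set _).integer (κ.layer N))ˣ) : _)
    refine ⟨e, y, ?_⟩
    rw [hy, Set.val_unitEquivUnitsInteger_apply_coe, Subgroup.coe_inv, Units.val_inv_eq_inv_val]
  choose e y hy using hU
  choose e' y' hy' using hU'
  set A : Fin k → 𝓞 (κ.layer N) := fun j => (m₀ : 𝓞 (κ.layer N)) ^ (2 * e j) * y j with hAdef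
  set B : Fin k → 𝓞 (κ.layer N) := fun j => (m₀ : 𝓞 (κ.layer N)) ^ (2 * e' j) * y' j with hBdef
  have hA : ∀ j, algebraMap (𝓞 (κ.layer N)) (κ.layer N) (A j) =
      (m₀ : κ.layer N) ^ (3 * e j) * ((u j : (κ.layer N)ˣ) : κ.layer N) := by
    intro j; simp only [hAdef, map_mul, map_pow, map_natCast, hy]; ring
  have hB : ∀ j, algebraMap (𝓞 (κ.layer N)) (κ.layer N) (B j) =
      (m₀ : κ.layer N) ^ (3 * e' j) * ((u j : (κ.layer N)ˣ)⁻¹ : (κ.layer N)ˣ) := by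
    intro j; simp only [hBdef, map_mul, map_pow, map_natCast, hy']; ring
  set a : Fin k → AlgebraicClosure ℚ :=
    fun j => ((algebraMap (𝓞 (κ.layer N)) (κ.layer N) (A j) : κ.layer N) : AlgebraicClosure ℚ) with hadef
  set b : Fin k → AlgebraicClosure ℚ :=
    fun j => ((algebraMap (𝓞 (κ.layer N)) (κ.layer N) (B j) : κ.layer N) : AlgebraicClosure ℚ) with hbdef
  set n : Fin k → ℕ := fun j => m₀ ^ (3 * (e j + e' j)) with hndef
  have haint : ∀ j, IsIntegral (𝓞 ℚ) (a j) := fun j =>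
    ((RingOfIntegers.isIntegral_coe (A j)).algebraMap (B := AlgebraicClosure ℚ)).tower_top
  have hbint : ∀ j, IsIntegral (𝓞 ℚ) (b j) := fun j =>
    ((RingOfIntegers.isIntegral_coe (B j)).algebraMap (B := AlgebraicClosure ℚ)).tower_top
  have hn0 : ∀ j, n j ≠ 0 := fun j => pow_ne_zero _ hm₀
  have hab : ∀ j, a j * b j = (n j : AlgebraicClosure ℚ) := by
    intro j
    have habK : algebraMap (𝓞 (κ.layer N)) (κ.layer N) (A j) *
        algebraMap (𝓞 (κ.layer N)) (κ.layer N) (B j) = ((n j : ℕ) : κ.layer N) := by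
      rw [hA, hB, hndef]
      push_cast
      rw [mul_mul_mul_comm, mul_inv_cancel₀ (Units.ne_zero _), mul_one, ← pow_add]
      ring_nf
    have h := congrArg (fun x : κ.layer N => (x : AlgebraicClosure ℚ)) habK
    simpa [hadef, hbdef] using h
  have hnS : ∀ j (v : HeightOneSpectrum (𝓞 ℚ)), ((n j : ℕ) : 𝓞 ℚ) ∈ v.asIdeal → v ∈ S₀ :=
    fun j v hv => hnS₀ _ v hv
  have hG'a : ∀ j, ∀ σ ∈ κ.layerSubgroup N, σ • a j = a j := fun j =>
    (ZpExtension.mem_layer_iff_forall_smul_eq κ N (a j)).mp (SetLike.coe_mem _)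
  have hm0K : (m₀ : κ.layer N) ≠ 0 := by exact_mod_cast hm₀
  -- an integral basis of `𝓞_{ℚ_N}` with integer structure constants
  obtain ⟨nb, bb, μ, -, hbb, hcoord, -⟩ := KummerFamily.exists_basis_structureConstants (κ.layer N)
  have hgood : ∀ j (τ : absoluteGaloisGroup ℚ), ∃ βτ : AlgebraicClosure ℚ, βτ ^ 3 = τ • a j ∧
      ∀ σ ∈ inertia ((Rat.HeightOneSpectrum.primesEquiv (R := 𝓞 ℚ)).symm ⟨3, Nat.prime_three⟩),
        σ ∈ κ.kerSubgroup → σ • βτ = βτ := by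
    intro j τ
    obtain ⟨d, t, hd0, hdt⟩ := hcong j
    obtain ⟨c, T, hc0, hcT⟩ := KummerFamily.exists_int_cube_mul_eq (K := κ.layer N) hm₀ h3 t
    obtain ⟨ed, yd, hyd⟩ := KummerFamily.exists_pow_mul_mem_range (K := κ.layer N) hm₀ d
    obtain ⟨tT, htT⟩ := hcoord T
    obtain ⟨ty, hty⟩ := hcoord yd
    -- the conjugate basis `τ b_l`
    set b' : Fin nb → AlgebraicClosure ℚ := fun l =>
      τ • ((algebraMap (𝓞 (κ.layer N)) (κ.layer N) (bb l) : κ.layer N) : AlgebraicClosure ℚ) with hb'def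
    have hb' : ∀ i i', b' i * b' i' = ∑ l, (μ l i i' : AlgebraicClosure ℚ) * b' l := by
      intro i i'
      have h1 : algebraMap (𝓞 (κ.layer N)) (κ.layer N) (bb i) *
          algebraMap (𝓞 (κ.layer N)) (κ.layer N) (bb i') =
          ∑ l, (μ l i i' : κ.layer N) * algebraMap (𝓞 (κ.layer N)) (κ.layer N) (bb l) := by
        rw [← map_mul, hbb i i', map_sum]
        simp only [zsmul_eq_mul, map_mul, map_intCast]
      have h2 := congrArg (fun z : κ.layer N => τ • (z : AlgebraicClosure ℚ)) h1
      push_cast at h2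
      simpa only [hb'def, absoluteGaloisGroup.smul_def, map_mul, map_sum, map_intCast] using h2
    -- the congruence `u (c d)³ = 1 + 9 T` in `ℚ_N`, transported by `τ`
    have hcongK : ((u j : (κ.layer N)ˣ) : κ.layer N) * ((c : κ.layer N) * (d : κ.layer N)) ^ 3 =
        1 + 9 * ∑ l, (tT l : κ.layer N) * algebraMap (𝓞 (κ.layer N)) (κ.layer N) (bb l) := by
      have h1 : ((u j : (κ.layer N)ˣ) : κ.layer N) * ((c : κ.layer N) * (d : κ.layer N)) ^ 3 =
          (c : κ.layer N) ^ 3 * (1 + 9 * (t : κ.layer N)) := by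
        rw [← hdt]; ring
      rw [h1, hcT, htT, map_sum]
      simp only [zsmul_eq_mul, map_mul, map_intCast]
    have h9 : ((9 : κ.layer N) : AlgebraicClosure ℚ) = 9 := by norm_cast
    have hcongC : (τ • (((u j : (κ.layer N)ˣ) : κ.layer N) : AlgebraicClosure ℚ)) *
        ((c : AlgebraicClosure ℚ) * τ • ((d : κ.layer N) : AlgebraicClosure ℚ)) ^ 3 =
        1 + 9 * ∑ l, (tT l : AlgebraicClosure ℚ) * b' l := by
      have h2 := congrArg (fun z : κ.layer N => τ • (z : AlgebraicClosure ℚ)) hcongK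
      push_cast at h2
      simpa only [hb'def, absoluteGaloisGroup.smul_def, map_mul, map_pow, map_add, map_one, map_sum,
        map_intCast, h9, map_ofNat] using h2
    -- `c · τ(d) ≠ 0`, and it is a rational combination of the `τ b_l`
    have hdK0 : (d : κ.layer N) ≠ 0 := fun h => hd0 (by exact_mod_cast h)
    have hd'0 : (c : AlgebraicClosure ℚ) * τ • ((d : κ.layer N) : AlgebraicClosure ℚ) ≠ 0 := by
      refine mul_ne_zero (by exact_mod_cast hc0) ?_
      rw [Ne, smul_eq_zero_iff_eq]
      exact_mod_cast hdK0
    have hdK : (d : κ.layer N) =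
        ((m₀ : κ.layer N) ^ ed)⁻¹ * ∑ l, (ty l : κ.layer N) * algebraMap (𝓞 (κ.layer N)) (κ.layer N) (bb l) := by
      have hm : ((m₀ : κ.layer N) ^ ed) ≠ 0 := pow_ne_zero _ hm0K
      have hd : (d : κ.layer N) = ((m₀ : κ.layer N) ^ ed)⁻¹ * algebraMap (𝓞 (κ.layer N)) (κ.layer N) yd := by
        rw [hyd, ← mul_assoc, inv_mul_cancel₀ hm, one_mul]
      rw [hd, hty, map_sum]
      simp only [zsmul_eq_mul, map_mul, map_intCast]
    have hd'eq : τ • ((d : κ.layer N) : AlgebraicClosure ℚ) =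
        ((m₀ : AlgebraicClosure ℚ) ^ ed)⁻¹ * ∑ l, (ty l : AlgebraicClosure ℚ) * b' l := by
      rw [hdK]
      push_cast
      simp only [hb'def, absoluteGaloisGroup.smul_def, map_mul, map_inv₀, map_pow, map_sum, map_intCast,
        map_natCast]
    have hdfix : ∀ σ ∈ decomp ((Rat.HeightOneSpectrum.primesEquiv (R := 𝓞 ℚ)).symm ⟨3, Nat.prime_three⟩),
        (∀ l, σ • b' l = b' l) →
        σ • ((c : AlgebraicClosure ℚ) * τ • ((d : κ.layer N) : AlgebraicClosure ℚ)) =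
          (c : AlgebraicClosure ℚ) * τ • ((d : κ.layer N) : AlgebraicClosure ℚ) := by
      intro σ _ hfix
      rw [hd'eq]
      simp only [absoluteGaloisGroup.smul_def] at hfix
      simp only [absoluteGaloisGroup.smul_def, map_mul, map_inv₀, map_pow, map_sum, map_intCast,
        map_natCast, hfix]
    -- U2: a good cube root of `τ u`
    obtain ⟨β, hβ3, hβfix⟩ :=
      KummerLayerClasses.exists_goodRoot_of_congruence μ hb' hd'0 tT hcongC hdfix
    refine ⟨(m₀ : AlgebraicClosure ℚ) ^ e j * β, ?_, ?_⟩
    · rw [mul_pow, ← pow_mul, hβ3, hadef]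
      simp only
      rw [hA j]
      push_cast
      rw [absoluteGaloisGroup.smul_def, absoluteGaloisGroup.smul_def, map_mul, map_pow, map_natCast,
        mul_comm (e j) 3]
    · intro σ hσI hσker
      have hσD := inertia_le_decomp _ hσI
      have hσb' : ∀ l, σ • b' l = b' l := fun l =>
        (ZpExtension.mem_layer_iff_forall_smul_eq κ N (b' l)).mp
          (ZpExtension.smul_mem_layer κ N (SetLike.coe_mem _) τ) σ
          (κ.kerSubgroup_le_layerSubgroup N hσker)
      rw [smul_mul', smul_pow', hβfix σ hσD hσb', absoluteGaloisGroup.smul_def, map_natCast]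
  have hindep : ∀ (dv : Fin k → ZMod 3) (γ : AlgebraicClosure ℚ),
      (∀ σ ∈ κ.layerSubgroup N, σ • γ = γ) → γ ^ 3 = ∏ j, a j ^ (dv j).val → dv = 0 := by
    intro dv γ hγfix hγ
    have hγmem : γ ∈ κ.layer N := (ZpExtension.mem_layer_iff_forall_smul_eq κ N γ).mpr hγfix
    -- `γ = x ∈ ℚ_N` with `x³ = ∏ A_j^{d_j}`
    set x : κ.layer N := ⟨γ, hγmem⟩ with hxdef
    have hx3 : x ^ 3 = ∏ j, algebraMap (𝓞 (κ.layer N)) (κ.layer N) (A j) ^ (dv j).val := by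
      apply Subtype.ext
      rw [SubmonoidClass.coe_pow, IntermediateField.coe_prod]
      simp only [SubmonoidClass.coe_pow]
      exact hγ
    -- `y = x / ∏ m₀^{e_j d_j}` has `y³ = ∏ u_j^{d_j}`
    set P : κ.layer N := ∏ j, (m₀ : κ.layer N) ^ (e j * (dv j).val) with hPdef
    have hP0 : P ≠ 0 := prod_ne_zero_iff.mpr fun j _ => pow_ne_zero _ hm0K
    have hP3 : P ^ 3 = ∏ j, ((m₀ : κ.layer N) ^ (3 * e j)) ^ (dv j).val := by
      rw [hPdef, ← prod_pow]
      refine prod_congr rfl fun j _ => ?_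
      rw [← pow_mul, ← pow_mul]; congr 1; ring
    set yK : κ.layer N := x * P⁻¹ with hyKdef
    have hy3 : yK ^ 3 = ∏ j, ((u j : (κ.layer N)ˣ) : κ.layer N) ^ (dv j).val := by
      rw [hyKdef, mul_pow, inv_pow, hx3, hP3]
      simp_rw [hA, mul_pow]
      rw [prod_mul_distrib, mul_comm, ← mul_assoc,
        inv_mul_cancel₀ (prod_ne_zero_iff.mpr fun j _ => pow_ne_zero _ (pow_ne_zero _ hm0K)), one_mul]
    have hy0 : yK ≠ 0 := by
      intro h0
      have h := hy3
      rw [h0, zero_pow three_ne_zero] at h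
      exact (prod_ne_zero_iff.mpr fun j _ => pow_ne_zero _ (Units.ne_zero _)) h.symm
    have hyS : ∀ w ∉ ({w | (m₀ : 𝓞 (κ.layer N)) ∈ w.asIdeal} : Set (HeightOneSpectrum (𝓞 (κ.layer N)))),
        w.valuation (κ.layer N) yK = 1 := by
      intro w hw
      apply KummerFamily.valuation_eq_one_of_pow (w.valuation (κ.layer N)) three_ne_zero
      rw [hy3, map_prod]
      exact prod_eq_one fun j _ => by rw [map_pow, (u j).2 w hw, one_pow]
    let Y : ({w | (m₀ : 𝓞 (κ.layer N)) ∈ w.asIdeal} : Set (HeightOneSpectrum (𝓞 (κ.layer N)))).unit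
        (κ.layer N) := ⟨Units.mk0 yK hy0, fun w hw => by simpa using hyS w hw⟩
    have hrel : (∏ j, u j ^ (dv j).val) = 1 * Y ^ 3 := by
      rw [one_mul]
      apply Subtype.ext
      apply Units.ext
      rw [SubmonoidClass.coe_finsetProd, Units.coe_prod, SubgroupClass.coe_pow, Units.val_pow_eq_pow_val,
        Units.val_mk0, hy3]
      exact prod_congr rfl fun j _ => by rw [SubgroupClass.coe_pow, Units.val_pow_eq_pow_val]
    exact hind dv 1 (one_mem _) Y hrel
  have hmain : 3 ^ Fintype.card (Fin k) ≤ Nat.card (residualQuotSelmer W 3 κ S₀ Φ₀ hΦ) :=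
    X3Branch.pow_card_le_natCard_residualQuotSelmer_of_trivialLine_of_family κ S₀ hΦ htriv
      (κ.layerSubgroup N) (κ.kerSubgroup_le_layerSubgroup N) a b haint hbint n hn0 hab hnS hG'a
      hgood hindep
  calc 3 ^ (Nat.card {w : HeightOneSpectrum (𝓞 (κ.layer N)) // (m₀ : 𝓞 (κ.layer N)) ∈ w.asIdeal} - 1)
      ≤ 3 ^ k := Nat.pow_le_pow_right (by norm_num) hkS
    _ = 3 ^ Fintype.card (Fin k) := by rw [Fintype.card_fin]
    _ ≤ _ := hmain

end Summit.BirchSwinnertonDyer.Rank1Residual.Additive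

end
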